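import Summits.ResolutionOfSingularities.ResolutionOfSingularities.Theorems.PurelyInseparableDim4JointWaitingCover
import Summits.ResolutionOfSingularities.ResolutionOfSingularities.Theorems.PurelyInseparableDim4JointForestStepModel
import HarnessLib

/-!
# Purely inseparable four-folds: the STEP of the joint forest at a root-type host WITH WAITING MEMBERS — children, waiting
# kids and leaves on the new stage (brick S3 (c) «joint point∘coordinate chains», part 37 = v3-lite step; cell `res-dim4-pi`)

[OURS · counted 0] (D-0157 DOOR 2; desk WORD #66 (4)(c), #74 (g), #99 (d); frame `PIDim4.TerminationImpliesOrderReduction`,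
S3 (c) v3-lite, memo `S3c-V3-DESIGN.md` Addenda 2–4; host item stmt-ResolutionOfSingularities-16155, helper). Nothing here
proves resolution of singularities in dimension ≥ 4 / characteristic `p` — NOT here, not anywhere in this programme.

The v2 step (parts 13/19) blows up a coordinate member `V(z, x_S)` with a PLAN of children `(j, b, S″)`, `S ⊆ S″` (inside the
exceptional divisor) and LEAVES. v3-lite adds WAITING ENTRIES `(j, c, T)` — `j ∈ S`, `c|_S = 0`, `S ∖ {j} ⊆ T`, `j ∉ T`, `T`
permissible for the kid state `step p S j c s` — the strict transforms of the waiting members `V(z, x_i − c_i : i ∈ T)` of the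
previous stage that MEET the host (memo Addendum 2: the components of an intersecting order-`p` locus wait while their
intersection pattern is blown up). For a ROOT-TYPE host (`ψ` onto, `φ(Y)` closed, empty boundary) this file assembles:

* **`joint_forest_step_waiting`** — children (part 37a) AND waiting kids (part 35) with their coordinate-member data;
  children pairwise disjoint; child ∩ waiting kid = ∅ (same chart: a separating coordinate in `S″ ∩ T`; different charts
  AUTOMATIC — the waiting kid is re-centred at `c` with `c_{j′} = 0` and `j′ ∈ T` for the child's chart `j′ ≠ j`, typ-2's
  `disjoint_image_CΛ_chart_of_ne_chart`); waiting kids pairwise disjoint (same chart: separating coordinate in `T ∩ T′`;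
  different charts automatic); COVER over the host by children and leaf charts (part 19); COVER OFF the host: a closed
  order-`p` point over `φ(ψ⁻¹{x_i − c_i ∈ 𝔭 (i ∈ T)})` off the host lies on the waiting kid of `(j, c, T)` (part 36);
  PROJECTION of each waiting kid into that set; finiteness of the leaf points (part 19).

No separation is asked between leaves and waiting entries (a listed leaf lying on a waiting kid is simply absorbed by it in the
node bookkeeping of part 38). AI-produced formalisation, weaker than expert review.
bears_on: LADDER-RESOLUTION:D157-DOOR2 (res-dim4-pi · S3 (c) joint v3-lite).
-/

set_option linter.dupNamespace false -- D-0017: single-problem summit path `Summit.<S>.<S>.…` by design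

noncomputable section

open MvPolynomial Finset CategoryTheory AlgebraicGeometry Opposite TopologicalSpace
open AlgebraicGeometry.Scheme.IdealSheafData (ofIdealTop vanishingIdeal)

namespace Summit.ResolutionOfSingularities.ResolutionOfSingularities.Theorems.PIDim4

open Literature.AlgebraicGeometry.Resolution
open Literature.AlgebraicGeometry.Resolution.Hauser2010
open Literature.AlgebraicGeometry.Resolution.AffinePointBlowup (P A γ coord Wtop ξ)

namespace Equimultiple

section WaitingStep

variable {K : Type} [Field K] {p : ℕ} [hp : Fact p.Prime] [CharP K p] [DecidableEq K]
variable {Z Y W Bl : Scheme.{0}} (φ : Y ⟶ Z) [IsOpenImmersion φ] (ψ : Y ⟶ P 4 K) [IsOpenImmersion ψ]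
  {π : W ⟶ Z} {B : Bl ⟶ P 4 K} {S : Finset (Fin 4)}
  (ε : (π ⁻¹ᵁ φ.opensRange : Scheme.{0}) ≅ (B ⁻¹ᵁ ψ.opensRange : Scheme.{0}))

/-- **THE STEP OF THE JOINT FOREST AT A ROOT-TYPE HOST WITH WAITING MEMBERS.** See the module docstring.
[cite: BierstoneGrigorievMilmanWlodarczyk2011, Def. 3.1.3; §4 Step 2b] [cite: Hauser2010, §§F–G]
[cite: GortzWedhorn2020, Prop. 13.91] -/
theorem joint_forest_step_waiting [IsLocallyNoetherian Z] [IsAlgClosed K] (Zc : Z.IdealSheafData)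
    (hπ : IsBlowup π Zc) (hB : IsBlowup B (AffineCoordBlowup.𝓘Λ 4 K (insert 0 (Fin.succ '' (S : Set (Fin 4))))))
    (hsq : ε.hom ≫ (B ∣_ ψ.opensRange) = (π ∣_ φ.opensRange) ≫ (φ.isoOpensRange.inv ≫ ψ.isoOpensRange.hom))
    (hC' : ((AffineCoordBlowup.𝓘Λ 4 K (insert 0 (Fin.succ '' (S : Set (Fin 4))))).comap ψ.opensRange.ι).comap
        (φ.isoOpensRange.inv ≫ ψ.isoOpensRange.hom) = Zc.comap φ.opensRange.ι)
    (M : MarkedIdeal Z) (hmult : M.mult = p) (hbd : M.boundary = []) (s : State K)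
    (hK : ((controlledTransform B (AffineCoordBlowup.𝓘Λ 4 K (insert 0 (Fin.succ '' (S : Set (Fin 4)))))
        (hypSheaf p s.F) p).comap (B ⁻¹ᵁ ψ.opensRange).ι).comap ε.hom =
      (controlledTransform π Zc M.ideal p).comap (π ⁻¹ᵁ φ.opensRange).ι) (hS : IsPermissibleCentre p S s.F)
    (hsee : (AffineCoordBlowup.CΛ 4 K (insert 0 (Fin.succ '' (S : Set (Fin 4)))) : Set (P 4 K)) ⊆ Set.range ψ)
    (hT : IsClosed (φ '' (ψ ⁻¹' (AffineCoordBlowup.CΛ 4 K (insert 0 (Fin.succ '' (S : Set (Fin 4)))) : Set (P 4 K)))))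
    (hψ : ∀ x : P 4 K, x ∈ Set.range ψ) (hφ : IsClosed (Set.range φ))
    (hsncZ : HasSNCWith M.boundary Zc)
    (Pl : Finset (Fin 4 × (Fin 4 → K) × Finset (Fin 4)))
    (hP1 : ∀ e ∈ Pl, e.1 ∈ S ∧ e.2.1 e.1 = 0 ∧ S ⊆ e.2.2 ∧ CentreBlowup.IsEquimultiplePoint p S e.1 e.2.1 s ∧
      IsPermissibleCentre p e.2.2 (CentreBlowup.step p S e.1 e.2.1 s).F)
    (hP2 : ∀ e ∈ Pl, ∀ e' ∈ Pl, e ≠ e' →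
      (e.1 = e'.1 ∧ ∃ i ∈ e.2.2, i ∈ e'.2.2 ∧ e.2.1 i ≠ e'.2.1 i) ∨
      (e.1 ≠ e'.1 ∧ ((e'.2.1 e.1 = 0 ∧ e.1 ∈ e'.2.2) ∨ (e.2.1 e'.1 = 0 ∧ e'.1 ∈ e.2.2))))
    (L : Finset (Fin 4 × (Fin 4 → K)))
    (hP5 : ∀ (j' : Fin 4) (b' : Fin 4 → K), j' ∈ S → b' j' = 0 → (∀ k ∈ S, k < j' → b' k = 0) →
      CentreBlowup.IsEquimultiplePoint p S j' b' s →
      (∃ e ∈ Pl, e.1 = j' ∧ ∀ i ∈ e.2.2, b' i = e.2.1 i) ∨ (j', b') ∈ L)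
    (Wt : Finset (Fin 4 × (Fin 4 → K) × Finset (Fin 4)))
    (hW1 : ∀ wt ∈ Wt, wt.1 ∈ S ∧ (∀ i ∈ S, wt.2.1 i = 0) ∧ S.erase wt.1 ⊆ wt.2.2 ∧ wt.1 ∉ wt.2.2 ∧
      IsPermissibleCentre p wt.2.2 (CentreBlowup.step p S wt.1 wt.2.1 s).F)
    (hW2 : ∀ wt ∈ Wt, ∀ wt' ∈ Wt, wt ≠ wt' → wt.1 = wt'.1 → ∃ i ∈ wt.2.2, i ∈ wt'.2.2 ∧ wt.2.1 i ≠ wt'.2.1 i)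
    (hPW : ∀ e ∈ Pl, ∀ wt ∈ Wt, e.1 = wt.1 → ∃ i ∈ e.2.2, i ∈ wt.2.2 ∧ e.2.1 i ≠ wt.2.1 i) :
    ∃ kid wkid : Fin 4 × (Fin 4 → K) × Finset (Fin 4) → Closeds W,
      (∀ e ∈ Pl,
        Scheme.IsRegular (vanishingIdeal (kid e)).subscheme ∧
        HasSNCWith (M.transform π Zc).boundary (vanishingIdeal (kid e)) ∧
        (∃ (Y'' : Scheme.{0}) (φ'' : Y'' ⟶ W) (ψ'' : Y'' ⟶ P 4 K) (_ : IsOpenImmersion φ'') (_ : IsOpenImmersion ψ''),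
          (M.transform π Zc).ideal.comap φ'' = (hypSheaf p (CentreBlowup.step p S e.1 e.2.1 s).F).comap ψ'' ∧
          (vanishingIdeal (kid e)).comap φ'' =
            (AffineCoordBlowup.𝓘Λ 4 K (insert 0 (Fin.succ '' ((e.2.2 : Finset (Fin 4)) : Set (Fin 4))))).comap ψ'' ∧
          (kid e : Set W) ⊆ Set.range φ'' ∧
          (AffineCoordBlowup.CΛ 4 K (insert 0 (Fin.succ '' ((e.2.2 : Finset (Fin 4)) : Set (Fin 4)))) : Set (P 4 K)) ⊆
            Set.range ψ'' ∧
          ∃ (idx₂ : W.IdealSheafData → Fin 4) (cst₂ : W.IdealSheafData → K),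
            (∀ D₂ ∈ (M.transform π Zc).boundary,
              ((D₂.support : Set W) ∩ φ'' '' (ψ'' ⁻¹'
                (AffineCoordBlowup.CΛ 4 K (insert 0 (Fin.succ '' ((e.2.2 : Finset (Fin 4)) : Set (Fin 4)))) :
                  Set (P 4 K)))).Nonempty →
              D₂.comap φ'' = (ofIdealTop (Ideal.span {(γ 4 K).symm (X (idx₂ D₂).succ + C (cst₂ D₂))})).comap ψ'' ∧
                (idx₂ D₂ ∈ e.2.2 → cst₂ D₂ = 0)) ∧
            (∀ D₁ ∈ (M.transform π Zc).boundary, ∀ D₂ ∈ (M.transform π Zc).boundary,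
              ((D₁.support : Set W) ∩ φ'' '' (ψ'' ⁻¹'
                (AffineCoordBlowup.CΛ 4 K (insert 0 (Fin.succ '' ((e.2.2 : Finset (Fin 4)) : Set (Fin 4)))) :
                  Set (P 4 K)))).Nonempty →
              ((D₂.support : Set W) ∩ φ'' '' (ψ'' ⁻¹'
                (AffineCoordBlowup.CΛ 4 K (insert 0 (Fin.succ '' ((e.2.2 : Finset (Fin 4)) : Set (Fin 4)))) :
                  Set (P 4 K)))).Nonempty →
              idx₂ D₁ = idx₂ D₂ → D₁ = D₂)) ∧
        (kid e : Set W) ⊆ π ⁻¹' (φ '' (ψ ⁻¹'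
          (AffineCoordBlowup.CΛ 4 K (insert 0 (Fin.succ '' (S : Set (Fin 4)))) : Set (P 4 K)))) ∧
        (kid e : Set W).Nonempty) ∧
      (∀ wt ∈ Wt,
        Scheme.IsRegular (vanishingIdeal (wkid wt)).subscheme ∧
        HasSNCWith (M.transform π Zc).boundary (vanishingIdeal (wkid wt)) ∧
        (∃ (Y'' : Scheme.{0}) (φ'' : Y'' ⟶ W) (ψ'' : Y'' ⟶ P 4 K) (_ : IsOpenImmersion φ'') (_ : IsOpenImmersion ψ''),
          (M.transform π Zc).ideal.comap φ'' = (hypSheaf p (CentreBlowup.step p S wt.1 wt.2.1 s).F).comap ψ'' ∧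
          (vanishingIdeal (wkid wt)).comap φ'' =
            (AffineCoordBlowup.𝓘Λ 4 K (insert 0 (Fin.succ '' ((wt.2.2 : Finset (Fin 4)) : Set (Fin 4))))).comap ψ'' ∧
          (wkid wt : Set W) ⊆ Set.range φ'' ∧
          (AffineCoordBlowup.CΛ 4 K (insert 0 (Fin.succ '' ((wt.2.2 : Finset (Fin 4)) : Set (Fin 4)))) : Set (P 4 K)) ⊆
            Set.range ψ'' ∧
          ∃ (idx₂ : W.IdealSheafData → Fin 4) (cst₂ : W.IdealSheafData → K),
            (∀ D₂ ∈ (M.transform π Zc).boundary,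
              ((D₂.support : Set W) ∩ φ'' '' (ψ'' ⁻¹'
                (AffineCoordBlowup.CΛ 4 K (insert 0 (Fin.succ '' ((wt.2.2 : Finset (Fin 4)) : Set (Fin 4)))) :
                  Set (P 4 K)))).Nonempty →
              D₂.comap φ'' = (ofIdealTop (Ideal.span {(γ 4 K).symm (X (idx₂ D₂).succ + C (cst₂ D₂))})).comap ψ'' ∧
                (idx₂ D₂ ∈ wt.2.2 → cst₂ D₂ = 0)) ∧
            (∀ D₁ ∈ (M.transform π Zc).boundary, ∀ D₂ ∈ (M.transform π Zc).boundary,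
              ((D₁.support : Set W) ∩ φ'' '' (ψ'' ⁻¹'
                (AffineCoordBlowup.CΛ 4 K (insert 0 (Fin.succ '' ((wt.2.2 : Finset (Fin 4)) : Set (Fin 4)))) :
                  Set (P 4 K)))).Nonempty →
              ((D₂.support : Set W) ∩ φ'' '' (ψ'' ⁻¹'
                (AffineCoordBlowup.CΛ 4 K (insert 0 (Fin.succ '' ((wt.2.2 : Finset (Fin 4)) : Set (Fin 4)))) :
                  Set (P 4 K)))).Nonempty →
              idx₂ D₁ = idx₂ D₂ → D₁ = D₂)) ∧
        (∀ w ∈ (wkid wt : Set W),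
          π w ∈ φ '' (ψ ⁻¹' {x : P 4 K | ∀ i ∈ wt.2.2, (X i.succ - C (wt.2.1 i) : A 4 K) ∈ x.asIdeal})) ∧
        (wkid wt : Set W).Nonempty) ∧
      (∀ e ∈ Pl, ∀ e' ∈ Pl, e ≠ e' → Disjoint (kid e : Set W) (kid e' : Set W)) ∧
      (∀ e ∈ Pl, ∀ wt ∈ Wt, Disjoint (kid e : Set W) (wkid wt : Set W)) ∧
      (∀ wt ∈ Wt, ∀ wt' ∈ Wt, wt ≠ wt' → Disjoint (wkid wt : Set W) (wkid wt' : Set W)) ∧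
      (∀ w : W, IsClosed ({w} : Set W) →
        π w ∈ φ '' (ψ ⁻¹' (AffineCoordBlowup.CΛ 4 K (insert 0 (Fin.succ '' (S : Set (Fin 4)))) : Set (P 4 K))) →
        (p : ℕ∞) ≤ idealOrder (M.transform π Zc).ideal w →
        (∃ e ∈ Pl, w ∈ (kid e : Set W)) ∨
        ∃ l ∈ L, l.1 ∈ S ∧ l.2 l.1 = 0 ∧ CentreBlowup.IsEquimultiplePoint p S l.1 l.2 s ∧
          ∃ (Y' : Scheme.{0}) (φ' : Y' ⟶ W) (ψ' : Y' ⟶ P 4 K) (_ : IsOpenImmersion φ') (_ : IsOpenImmersion ψ')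
            (y' : Y'), φ' y' = w ∧ ψ' y' = ξ 4 K ∧
            (M.transform π Zc).ideal.comap φ' = (hypSheaf p (CentreBlowup.step p S l.1 l.2 s).F).comap ψ') ∧
      (∀ w : W, IsClosed ({w} : Set W) → (p : ℕ∞) ≤ idealOrder (M.transform π Zc).ideal w →
        π w ∉ φ '' (ψ ⁻¹' (AffineCoordBlowup.CΛ 4 K (insert 0 (Fin.succ '' (S : Set (Fin 4)))) : Set (P 4 K))) →
        ∀ wt ∈ Wt, π w ∈ φ '' (ψ ⁻¹' {x : P 4 K | ∀ i ∈ wt.2.2, (X i.succ - C (wt.2.1 i) : A 4 K) ∈ x.asIdeal}) →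
          w ∈ (wkid wt : Set W)) ∧
      {w : W | IsClosed ({w} : Set W) ∧
        π w ∈ φ '' (ψ ⁻¹' (AffineCoordBlowup.CΛ 4 K (insert 0 (Fin.succ '' (S : Set (Fin 4)))) : Set (P 4 K))) ∧
        (p : ℕ∞) ≤ idealOrder (M.transform π Zc).ideal w ∧ ∀ e ∈ Pl, w ∉ (kid e : Set W)}.Finite := by
  classical
  -- the children, through the given `ε`, with their model descriptions
  obtain ⟨kid, hkid, hkdisj, hkcover, hkfin⟩ := joint_forest_step_model φ ψ ε Zc hπ hB hsq hC' M hmult s hK hS hsee hT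
    hsncZ (fun _ => 0) (fun _ => 0) (fun D hD => by simp [hbd] at hD) (fun D hD => by simp [hbd] at hD) Pl hP1 hP2 L hP5
  -- the waiting kids
  have wkidEx := fun (wt : Fin 4 × (Fin 4 → K) × Finset (Fin 4)) (hwt : wt ∈ Wt) =>
    waiting_kid_package_of_iso φ ψ ε Zc hπ hB hsq hC' M hmult hbd s hK hS.2 hsee hT hψ hφ hsncZ (hW1 wt hwt).1
      ((hW1 wt hwt).2.1 _ (hW1 wt hwt).1) (hW1 wt hwt).2.1 (hW1 wt hwt).2.2.1 (hW1 wt hwt).2.2.2.1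
  let wkid : Fin 4 × (Fin 4 → K) × Finset (Fin 4) → Closeds W := fun wt =>
    if hwt : wt ∈ Wt then (wkidEx wt hwt).choose else ⊥
  have hwkid : ∀ wt (hwt : wt ∈ Wt), wkid wt = (wkidEx wt hwt).choose := fun wt hwt => dif_pos hwt
  refine ⟨kid, wkid, fun e he => ?_, fun wt hwt => ?_, hkdisj, fun e he wt hwt => ?_, fun wt hwt wt' hwt' hne => ?_,
    hkcover, fun w hw hord hoff wt hwt hwT => ?_, hkfin⟩
  · -- data of a child
    obtain ⟨hreg, hsnc, hzig, hover, hne, -⟩ := hkid e he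
    exact ⟨hreg, hsnc, hzig, hover, hne⟩
  · -- data of a waiting kid
    rw [hwkid wt hwt]
    obtain ⟨Θ, -, -, -, hproj, hne, hreg, hsnc, hzig⟩ := (wkidEx wt hwt).choose_spec
    exact ⟨hreg, hsnc, hzig, hproj, hne⟩
  · -- a child and a waiting kid are disjoint
    rw [hwkid wt hwt]
    obtain ⟨-, -, -, hover, -, Θ, hs, hc, hmem⟩ := hkid e he
    obtain ⟨Θ', hs', hc', hmem', -⟩ := (wkidEx wt hwt).choose_spec
    have hsR : ∀ k : Fin 4, (Θ : A 4 K →+* A 4 K) (X k.succ) = X k.succ + C (e.2.1 k) := fun k => hs k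
    have hsR' : ∀ k : Fin 4, (Θ' : A 4 K →+* A 4 K) (X k.succ) = X k.succ + C (wt.2.1 k) := fun k => hs' k
    have hCR : ∀ r : K, (Θ : A 4 K →+* A 4 K) (C r) = C r := fun r => Θ.commutes r
    have hCR' : ∀ r : K, (Θ' : A 4 K →+* A 4 K) (C r) = C r := fun r => Θ'.commutes r
    rw [Set.disjoint_left]
    intro w hw hw'
    have hwV : w ∈ π ⁻¹ᵁ φ.opensRange := by
      obtain ⟨y, -, hy⟩ := hover hw
      exact ⟨y, hy⟩
    have h1 := (hmem w hwV).mp hw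
    have h2 := (hmem' w hwV).mp hw'
    by_cases hjj : e.1 = wt.1
    · -- same chart, separated on `S″ ∩ T`
      obtain ⟨i, hi, hi', hbi⟩ := hPW e he wt hwt hjj
      obtain ⟨j, b, S''⟩ := e
      obtain ⟨j', c, T⟩ := wt
      simp only at hjj hi hi' hbi hsR hsR' h1 h2
      subst hjj
      exact Set.disjoint_left.mp (ChartDictionary.disjoint_image_CΛ_chart_of_ne (hP1 _ he).1 hCR hsR hCR' hsR' hB
        hi hi' hbi) h1 h2
    · -- different charts: the waiting kid is re-centred at `c` with `c_{j} = 0`, and `j ∈ T`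
      have hjT : e.1 ∈ wt.2.2 := (hW1 wt hwt).2.2.1 (Finset.mem_erase.mpr ⟨hjj, (hP1 e he).1⟩)
      exact Set.disjoint_left.mp (ChartDictionary.disjoint_image_CΛ_chart_of_ne_chart (hP1 e he).1 (hW1 wt hwt).1
        hjj hsR' ((hW1 wt hwt).2.1 _ (hP1 e he).1) hB hjT) h1 h2
  · -- two waiting kids are disjoint
    rw [hwkid wt hwt, hwkid wt' hwt']
    obtain ⟨Θ, hs, hc, hmem, hproj, -⟩ := (wkidEx wt hwt).choose_spec
    obtain ⟨Θ', hs', hc', hmem', -⟩ := (wkidEx wt' hwt').choose_spec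
    have hsR : ∀ k : Fin 4, (Θ : A 4 K →+* A 4 K) (X k.succ) = X k.succ + C (wt.2.1 k) := fun k => hs k
    have hsR' : ∀ k : Fin 4, (Θ' : A 4 K →+* A 4 K) (X k.succ) = X k.succ + C (wt'.2.1 k) := fun k => hs' k
    have hCR : ∀ r : K, (Θ : A 4 K →+* A 4 K) (C r) = C r := fun r => Θ.commutes r
    have hCR' : ∀ r : K, (Θ' : A 4 K →+* A 4 K) (C r) = C r := fun r => Θ'.commutes r
    rw [Set.disjoint_left]
    intro w hw hw'
    have hwV : w ∈ π ⁻¹ᵁ φ.opensRange := by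
      obtain ⟨y, -, hy⟩ := hproj w hw
      exact ⟨y, hy⟩
    have h1 := (hmem w hwV).mp hw
    have h2 := (hmem' w hwV).mp hw'
    by_cases hjj : wt.1 = wt'.1
    · -- same chart, separated on `T ∩ T′`
      obtain ⟨i, hi, hi', hbi⟩ := hW2 wt hwt wt' hwt' hne hjj
      obtain ⟨j, c, T⟩ := wt
      obtain ⟨j', c', T'⟩ := wt'
      simp only at hjj hi hi' hbi hsR hsR' h1 h2
      subst hjj
      exact Set.disjoint_left.mp (ChartDictionary.disjoint_image_CΛ_chart_of_ne (hW1 _ hwt).1 hCR hsR hCR' hsR' hB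
        hi hi' hbi) h1 h2
    · -- different charts: automatic
      have hjT : wt.1 ∈ wt'.2.2 := (hW1 wt' hwt').2.2.1 (Finset.mem_erase.mpr ⟨hjj, (hW1 wt hwt).1⟩)
      exact Set.disjoint_left.mp (ChartDictionary.disjoint_image_CΛ_chart_of_ne_chart (hW1 wt hwt).1 (hW1 wt' hwt').1
        hjj hsR' ((hW1 wt' hwt').2.1 _ (hW1 wt hwt).1) hB hjT) h1 h2
  · -- a closed order-`p` point off the host over the waiting coordinates lies on the waiting kid
    rw [hwkid wt hwt]
    obtain ⟨Θ, hs, hc, hmem, -⟩ := (wkidEx wt hwt).choose_spec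
    have hwV : w ∈ π ⁻¹ᵁ φ.opensRange := by
      obtain ⟨y, -, hy⟩ := hwT
      exact ⟨y, hy⟩
    rw [hmem w hwV]
    exact ιε_mem_image_CΛ_of_off_host φ ψ ε Zc hB hsq M hmult s hK hS.2 (hW1 wt hwt).1 (hW1 wt hwt).2.1
      (hW1 wt hwt).2.2.1 (hW1 wt hwt).2.2.2.1 hs (hW1 wt hwt).2.2.2.2.2 hc hw hwV hord hoff hwT

end WaitingStep

end Equimultiple

end Summit.ResolutionOfSingularities.ResolutionOfSingularities.Theorems.PIDim4

end
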